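import Mathlib
import HarnessLib
import Summits.NavierStokesRegularity.NavierStokesRegularity.Theses.PoloidalWindowDoor

/-!
# Census sketch (cstrat g3, stmt-NavierStokesRegularity-19708): the typed signatures quoted in STRATEGY-CENSUS-g3.md
Nothing here is claimed true or proved; these are the statements S⁺ / decomposition pieces / first lemmas whose (lack of)
leverage the census records.  Not NS regularity.
-/

noncomputable section

namespace Summit.NavierStokesRegularity.NavierStokesRegularity.Cruxes.PoloidalWindowRigidity.CensusG3

open Literature.Analysis Literature.Analysis.FluidPDE Filter Topology
open scoped RealInnerProductSpace InnerProductSpace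

set_option linter.dupNamespace false

/-- the route's class (hypotheses of `PoloidalWindowRigidity`) plus poloidality along `e₂` on every slice. -/
def InClass (C : ℝ) (v : ℝ → EuclideanSpace ℝ (Fin 3) → EuclideanSpace ℝ (Fin 3)) : Prop :=
  HasTypeITimeDecay C v ∧ ContinuousOn (Function.uncurry v) (Set.Iio (0:ℝ) ×ˢ Set.univ) ∧
  (∀ s t : ℝ, s < t → t < 0 → ∀ x,
      v t x = UnboundedOperators.heatExtension (v s) (t - s) x - oseenDuhamel 1 s v v t x) ∧
  (∀ t < 0, VectorCalculus.IsDivFree (v t)) ∧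
  (∀ s < 0, ∀ y, ⟪curl (v s) y, EuclideanSpace.single 2 1⟫_ℝ = 0)

/-- global (TH) normal form with slope `μ(t,z)` (shape of `…TimeHeightShearNormalForm.timeHeightShear_normalForm`). -/
def IsTHSlope (v : ℝ → EuclideanSpace ℝ (Fin 3) → EuclideanSpace ℝ (Fin 3)) (μ : ℝ → ℝ → ℝ) : Prop :=
  ∀ s < 0, ∀ y, ∀ b : Fin 3, b ≠ 2 →
    fderiv ℝ (v s) y (EuclideanSpace.single 2 1) b = μ s (y 2) * fderiv ℝ (v s) y (EuclideanSpace.single b 1) 2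

/-- the scale-invariant PIN STRENGTH `|μ_z(t,z)|·√(−t)`. -/
def pin (μ : ℝ → ℝ → ℝ) (s z : ℝ) : ℝ := |deriv (μ s) z| * Real.sqrt (-s)

/-- S⁺₁ «WEAK-PIN LIOUVILLE»: a hyperbolic (TH) class profile whose pin is uniformly ε-small in every past is trivial. -/
def WeakPinLiouville : Prop :=
  ∃ ε > 0, ∀ (C : ℝ) (v : ℝ → EuclideanSpace ℝ (Fin 3) → EuclideanSpace ℝ (Fin 3)) (μ : ℝ → ℝ → ℝ),
    InClass C v → IsTHSlope v μ → (∀ s < 0, ∀ z, μ s z < 0) → (∀ s < 0, ∀ z, pin μ s z ≤ ε) →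
    ∀ s < 0, ∀ y, v s y = 0

/-- D5, the complementary piece «STRONG PIN»: the crux restricted to profiles whose pin is ≥ ε somewhere in every past. -/
def StrongPinResidue : Prop :=
  ∀ ε > 0, ∀ (C : ℝ) (v : ℝ → EuclideanSpace ℝ (Fin 3) → EuclideanSpace ℝ (Fin 3)) (μ : ℝ → ℝ → ℝ),
    InClass C v → IsTHSlope v μ → (∀ s < 0, ∀ z, μ s z < 0) → (∀ T < 0, ∃ s < T, ∃ z, ε ≤ pin μ s z) →
    ¬ IsBackwardSingularPoint v 0

/-- B1 «CLASS CLOSURE UNDER APEX ZOOM» (first lemma of the critical-element move): zooms of a class profile at the apex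
subconverge, with their gradients, to a class profile with the same constant. -/
def ClassZoomClosure : Prop :=
  ∀ (C : ℝ) (v : ℝ → EuclideanSpace ℝ (Fin 3) → EuclideanSpace ℝ (Fin 3)) (lam : ℕ → ℝ),
    InClass C v → (∀ j, 0 < lam j) → Tendsto lam atTop (𝓝 0) →
    ∃ (φ : ℕ → ℕ) (V : ℝ → EuclideanSpace ℝ (Fin 3) → EuclideanSpace ℝ (Fin 3)), StrictMono φ ∧ InClass C V ∧
      (∀ t < 0, TendstoLocallyUniformly (fun j x => lam (φ j) • v (lam (φ j) ^ 2 * t) (lam (φ j) • x)) (V t) atTop) ∧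
      (∀ t < 0, TendstoLocallyUniformly
        (fun j x => fderiv ℝ (fun y => lam (φ j) • v (lam (φ j) ^ 2 * t) (lam (φ j) • y)) x) (fun x => fderiv ℝ (V t) x) atTop)

/-- B2 «APEX PERSISTENCE INSIDE THE CLASS» — the statement a second zoom would need and that the class AS TYPED does not
supply (no local-energy / Morrey bound at the apex; compare `Literature.Analysis.FluidPDE.PersistenceOfSingularities`). -/
def ApexPersistenceInClass : Prop :=
  ∀ (C : ℝ) (v V : ℝ → EuclideanSpace ℝ (Fin 3) → EuclideanSpace ℝ (Fin 3)) (lam : ℕ → ℝ),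
    InClass C v → InClass C V → (∀ j, 0 < lam j) → Tendsto lam atTop (𝓝 0) →
    (∀ t < 0, TendstoLocallyUniformly (fun j x => lam j • v (lam j ^ 2 * t) (lam j • x)) (V t) atTop) →
    IsBackwardSingularPoint v 0 → IsBackwardSingularPoint V 0

/-- S⁺₃ «APEX-CONTINUOUS SLOPE»: if the slope extends continuously to the apex `(t,z) → (0⁻,0)`, the profile is regular
(tangent slopes freeze to the constant `μ(0,0)`; constant slope is a closed stratum, `…ConstantShear.nonflatLiouville_of_constantShear`). -/
def ApexContinuousSlopeRegular : Prop :=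
  ∀ (C : ℝ) (v : ℝ → EuclideanSpace ℝ (Fin 3) → EuclideanSpace ℝ (Fin 3)) (μ : ℝ → ℝ → ℝ) (m : ℝ),
    InClass C v → IsTHSlope v μ →
    Tendsto (Function.uncurry μ) (𝓝[Set.Iio (0:ℝ) ×ˢ Set.univ] ((0:ℝ), (0:ℝ))) (𝓝 m) →
    ¬ IsBackwardSingularPoint v 0

/-- S⁺₂ «EXTREMAL NORMALISATION» (critical element by translation–scaling compactness): WLOG the scale-invariant speed
`|v(t,x)|√(−t)` attains its supremum at `(−1,0)`. -/
def ExtremalResidueEmpty : Prop :=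
  ∀ (C : ℝ) (v : ℝ → EuclideanSpace ℝ (Fin 3) → EuclideanSpace ℝ (Fin 3)) (μ : ℝ → ℝ → ℝ),
    InClass C v → IsTHSlope v μ → (∀ s < 0, ∀ z, μ s z < 0) →
    (∀ t < 0, ∀ x, ‖v t x‖ * Real.sqrt (-t) ≤ ‖v (-1) 0‖) → v (-1) 0 ≠ 0 → False

/-- sanity: the pieces are stated over the crux's own objects. -/
example : WeakPinLiouville → StrongPinResidue → True := fun _ _ => trivial

end Summit.NavierStokesRegularity.NavierStokesRegularity.Cruxes.PoloidalWindowRigidity.CensusG3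

end
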